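import Summits.HodgeConjecture.HodgeConjecture.Theorems.F0P6aStubESHEETSocket
import HarnessLib

/-!
# `F0P6aStubESHEETOrgans` — ★ RE-HOME of `Lines/F0_P6a_StubESHEET.lean`, PART 2 of 3 (size-lint split; cut at a declaration boundary).

## Import provenance
- `Theorems.F0P6aStubESHEETSocket` = ★ previous part of the same `Lines` workfile `F0_P6a_StubESHEET` (size-lint split ×3); `HarnessLib`.

See PART 1 `Theorems/F0P6aStubESHEETSocket.lean` for the full re-home header and the original module docstring (verbatim there). Namespaces and sections KEPT
(re-opened below exactly as they stand at the cut, with their `open`∕`variable` lines replayed); code bytes = the workfile՚s, docstrings included; options preamble repeated from PART 1.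
HC_CM is proved only modulo the 7 printed citations (2 remaining: hLiu418 = stmt-HodgeConjecture-24832, h413 = stmt-HodgeConjecture-24833) until rung 0 closes; a re-home is count-neutral. -/

set_option autoImplicit false

noncomputable section


namespace Summit.HodgeConjecture.HodgeConjecture.Cruxes.HLiu418.F0P6aStubESHEET
set_option linter.dupNamespace false  -- `Summit.HodgeConjecture.HodgeConjecture.…` BY DESIGN (D-0017)
open CategoryTheory CategoryTheory.Limits NumberField IsDedekindDomain MulAction AlgebraicGeometry
open scoped Matrix Polynomial Pointwise nonZeroDivisors
open Literature.NumberTheory.GaloisRepresentations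
open Literature.NumberTheory.Automorphic Literature.NumberTheory.Automorphic.UnitaryGroup
open Literature.AlgebraicGeometry.ShimuraVarieties Literature.AlgebraicGeometry.ShimuraVarieties.UnitaryCanonicalModel
open Literature.NumberTheory.Automorphic.Liu2021.AppendixC
open Literature.AlgebraicGeometry.Motives (AlgPoints ComplexPoints SchemeOver thickeningLift specOver)
open Literature.AlgebraicGeometry.Motives.AbelianVariety (bcSpec)
open Literature.AlgebraicGeometry.AbelianSchemes (PolarizedAbelianSchemeWithLevel AbelianSchemeOver)
open Literature.AlgebraicGeometry.ModuliOfAbelianVarieties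
open Summit.HodgeConjecture.HodgeConjecture.Cruxes.HLiu418.F0P6aPELWitnessE
open Summit.HodgeConjecture.HodgeConjecture.Cruxes.HLiu418.F0P6aStubE6 (RingActionReading)
open Summit.HodgeConjecture.HodgeConjecture.Cruxes.HLiu418.F0P6aStubKOTT (KottAdaptedAt UnmixedAt)
open Summit.HodgeConjecture.HodgeConjecture.Cruxes.HLiu418.F0P6aEReadings (ETwistKerAt CoverKerE CoverE)
open Summit.HodgeConjecture.HodgeConjecture.Cruxes.HLiu418.F0P6aChartFramePin (IsChartOfFrame)
open Literature.AlgebraicGeometry.Motives (CMType)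
open Literature.AlgebraicGeometry.ShimuraVarieties.UnitaryCanonicalModel.Aux (ratBasis torusFinAdelic reflexField numberField_reflexField)
open Literature.AlgebraicGeometry.ShimuraVarieties.UnitaryCurve Literature.AlgebraicGeometry.ShimuraVarieties.UnitaryCurve.AuxV
open Literature.NumberTheory.ComplexMultiplication (reflexNormFiniteIdele)
open Literature.NumberTheory.ComplexMultiplication.CMTypeOps (flip bar)


/-- **(S7-F) THE FROBENIUS PIN READ ON `F`** (LA4-p04 (g2), ★ p849648 `canonicalTwistIdeal_eq_idealReflexTypeNorm_sigma` at `Lg := F`, `ι := ι₁`, `j := σ₀ := id`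
+ the type identity `valuedIn ι₁ Φ_tw = {φ | mOf ι₁ Φ (ι₁ ∘ φ) ≠ 0 ∧ φ off 𝔭_{c•w}}` forced by the Kottwitz count under `KottAdaptedAt`): the reflex type norm of `𝔭_w`
for the twist type, read on `F`, IS the canonical twist ideal `𝔞_can(mOf ι₁ Φ (σ₁ ∘ ·), τR₁, w)`.  PAID by ★ p850372 `Theorems/F0P6aTwistTypeFrobeniusPin` (LA4-p04 (g3)) — one application below.
[cite: Shimura1998, §13.1 Thm. 1 (1), (7) pp. 97–99] [cite: RapoportSmithlingZhang2020Diagonal, §4.1 (4.6) p. 16 and p. 17] -/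
theorem s7F_pin {F : Type} [Field F] [NumberField F] [IsCMField F] [IsGalois ℚ F] (ι₁ : F →+* ℂ) (Φ : Set (F →+* ℂ)) (hΦ : IsCMTypeThrough ι₁ Φ)
    (w : HeightOneSpectrum (𝓞 F)) (hw : (IsCMField.complexConj F) • w ≠ w)
    (σ₁ : AlgebraicClosure (w.adicCompletion F) →+* ℂ)
    (hσ₁ : σ₁.comp ((algebraMap (w.adicCompletion F) (AlgebraicClosure (w.adicCompletion F))).comp (algebraMap F (w.adicCompletion F))) = ι₁)
    (τR₁ : (F →+* AlgebraicClosure (w.adicCompletion F)) → (𝓞 F →+* ↥(closureValuationSubring (w.adicCompletion F))))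
    (hτR₁ : ∀ (τ : F →+* AlgebraicClosure (w.adicCompletion F)) (x : 𝓞 F),
      ((τR₁ τ x : ↥(closureValuationSubring (w.adicCompletion F))) : AlgebraicClosure (w.adicCompletion F)) = τ (x : F))
    (had : KottAdaptedAt ι₁ w Φ) :
    Literature.NumberTheory.ComplexMultiplication.idealReflexTypeNorm
        (Literature.NumberTheory.ComplexMultiplication.valuedIn ι₁ (twistType ι₁ Φ hΦ).1) (RingHom.id F) (RingHom.id F) w.asIdeal =
      ∏ τ ∈ Finset.univ.filter (fun τ : F →+* AlgebraicClosure (w.adicCompletion F) =>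
          mOf ι₁ Φ (σ₁.comp τ) ≠ 0 ∧ RingHom.ker ((IsLocalRing.residue ↥(closureValuationSubring (w.adicCompletion F))).comp (τR₁ τ)) ≠
            (((IsCMField.complexConj F) • w).asIdeal : Ideal (𝓞 F))),
        RingHom.ker ((IsLocalRing.residue ↥(closureValuationSubring (w.adicCompletion F))).comp (τR₁ τ)) :=
  -- (S7-F) ★ p850372 `Theorems/F0P6aTwistTypeFrobeniusPin` (LA4-p04 (g3)): ONE application + the `mOf` shape
  Summit.HodgeConjecture.HodgeConjecture.Theorems.F0P6aTwistTypeFrobeniusPin.idealReflexTypeNorm_valuedIn_flip_bar_eq_prod_filter_of_kottAdaptedAt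
    w τR₁ hτR₁ ι₁ σ₁ hσ₁ hw ⟨Φ, hΦ.2⟩ hΦ.1 (mOf ι₁ Φ)
    (fun φ => by
      unfold mOf
      split_ifs with h1 h2 <;> simp only [ne_eq, one_ne_zero, not_false_eq_true, true_iff, not_true_eq_false, false_iff,
        OfNat.ofNat_ne_zero, not_or, not_not] <;> tauto)
    had

/-! ### §2 ORGAN «TWIST DATA» (arithmetic: (S6) ⊕ (S7)) -/

set_option maxHeartbeats 400000 in
/-- **`OrganTWIST`** — for every CM `F∕ℚ` Galois, `ι₁`, slice field `Fᵢ∕F` Galois with `τE ∣ ι₁`, frame `Φ ∋ ι₁`, level `N ≥ 3`, and every place context of the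
letter (`w` with `c•w ≠ w`, `p` prime, `p ∈ 𝔭_w`, `N(𝔭_{c•w}) = p ^ f`, `p ∤ N`, `KottAdaptedAt`∕`UnmixedAt`) and datum sheet `e : Fᵢ → F̄_w`: TWIST DATA
`(𝔞_γ, n_γ)_γ` with the letter՚s SEVEN arithmetic rows (a)(b)(c)(FROB-𝔞)(FROB-n)(π1)(FROB-can) TOKEN FOR TOKEN (`C.N ↦ N`) AND `∀ γ, IsSheetTwistOf ι₁ τE Φ hΦ N γ (𝔞_γ) (n_γ)`.
ROAD (organ hands): `sE_γ := u⁻¹` for a level-adapted INTEGRAL correspondent `u ↔ γ̃⁻¹` (so `z = t(sE_γ) = t(u)⁻¹`, `𝔞_γ := [t(u)] = g_{Φ_tw}((u))` integral, prime to `N·p`, `z ≡ 1 mod N`; ★ p850039 `IsArtinCorrespondent.inv'`) (★ p849693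
`exists_mul_unitEmbedding_integral_congr`, ★ p849712 `exists_twistData_letterRows` type-product rows, ★ p849752); on the Frobenius coset of the decomposition
group of `e` the pin `[t(ϖ_w-idèle)] = 𝔞_can(mOf ι₁ Φ (σ₀ ∘ ·), τR, w)` (★ (S7) p849648 `canonicalTwistIdeal_eq_idealReflexTypeNorm_sigma` + ★ `toFractionalIdeal_reflexNormFiniteIdele`
under `KottAdaptedAt`∕`UnmixedAt`, inertia idèles are units), whose rows are ★ p849355 `canonicalTwistIdeal_eLetterRows_sigma`.  NOT asserted here (socket `stub_TWIST`).
Why it might fail: the `≡ 1 mod N` representative must be found INSIDE the correspondent class `sE·E♯^×` (not `sE·F^×`): ★ p849693 is applied over `E♯` with modulus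
`N·𝔡`, and `t = N_{Φ_tw}` of an `E♯`-idèle `≡ 1 mod N·𝔡` is `≡ 1 mod N` — the type-product congruence of ★ p849712.
(print: Shimura1998, §18.6 proof pp. 127–129) (print: MilneCM2006, Ch. I §1 Prop. 1.26 (11)) (print: RapoportSmithlingZhang2020Diagonal, §4.1 (4.6) p. 16, §4.3 p. 20) -/
def OrganTWIST : Prop :=
  ∀ (F : Type) [Field F] [NumberField F] [IsCMField F] [IsGalois ℚ F] (ι₁ : F →+* ℂ)
    (Fi : Type) [Field Fi] [NumberField Fi] [Algebra F Fi] [IsGalois F Fi] (τE : Fi →+* ℂ) (_hτE : τE.comp (algebraMap F Fi) = ι₁)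
    (Φ : Set (F →+* ℂ)) (hΦ : IsCMTypeThrough ι₁ Φ) (N : ℕ) (_hN : 3 ≤ N),
    ∀ (w : HeightOneSpectrum (𝓞 F)) (_hw : (IsCMField.complexConj F) • w ≠ w),
      ∀ (pChar fDeg : ℕ), Nat.Prime pChar → (pChar : 𝓞 F) ∈ w.asIdeal →
        Nat.card (𝓞 F ⧸ ((IsCMField.complexConj F) • w).asIdeal) = pChar ^ fDeg → ¬ pChar ∣ N →
        KottAdaptedAt ι₁ w Φ → UnmixedAt ι₁ w Φ →
        ∀ (e : Fi →ₐ[F] AlgebraicClosure (w.adicCompletion F)),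
  ∃ (twistIdeal : (Fi ≃ₐ[F] Fi) → Ideal (𝓞 F)) (twistNorm : (Fi ≃ₐ[F] Fi) → ℕ),
    (∀ γ : Fi ≃ₐ[F] Fi, Ideal.span {((twistNorm γ : ℕ) : 𝓞 F)} = twistIdeal γ * (IsCMField.complexConj F) • twistIdeal γ) ∧
    (∀ γ : Fi ≃ₐ[F] Fi, twistIdeal γ ⊔ Ideal.span {((N : ℕ) : 𝓞 F)} = ⊤) ∧
    (∀ γ : Fi ≃ₐ[F] Fi, twistIdeal γ ≠ ⊥) ∧
    (∀ (σ : Field.absoluteGaloisGroup (w.adicCompletion F)), IsAbsArithFrob σ → ∀ γ : Fi ≃ₐ[F] Fi,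
      ((AlgEquiv.restrictScalars F (Field.absoluteGaloisGroup.toAlgEquiv (w.adicCompletion F) σ) :
          AlgebraicClosure (w.adicCompletion F) ≃ₐ[F] AlgebraicClosure (w.adicCompletion F)) :
          AlgebraicClosure (w.adicCompletion F) →ₐ[F] AlgebraicClosure (w.adicCompletion F)).comp e = e.comp (γ : Fi →ₐ[F] Fi) →
      w.asIdeal ∣ twistIdeal γ) ∧
    (∀ (σ : Field.absoluteGaloisGroup (w.adicCompletion F)), IsAbsArithFrob σ → ∀ γ : Fi ≃ₐ[F] Fi,
      ((AlgEquiv.restrictScalars F (Field.absoluteGaloisGroup.toAlgEquiv (w.adicCompletion F) σ) :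
          AlgebraicClosure (w.adicCompletion F) ≃ₐ[F] AlgebraicClosure (w.adicCompletion F)) :
          AlgebraicClosure (w.adicCompletion F) →ₐ[F] AlgebraicClosure (w.adicCompletion F)).comp e = e.comp (γ : Fi →ₐ[F] Fi) →
      twistNorm γ = pChar ^ fDeg) ∧
    (∀ (σ : Field.absoluteGaloisGroup (w.adicCompletion F)), IsAbsArithFrob σ → ∀ γ : Fi ≃ₐ[F] Fi,
      ((AlgEquiv.restrictScalars F (Field.absoluteGaloisGroup.toAlgEquiv (w.adicCompletion F) σ) :
          AlgebraicClosure (w.adicCompletion F) ≃ₐ[F] AlgebraicClosure (w.adicCompletion F)) :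
          AlgebraicClosure (w.adicCompletion F) →ₐ[F] AlgebraicClosure (w.adicCompletion F)).comp e = e.comp (γ : Fi →ₐ[F] Fi) →
      twistIdeal γ ⊔ (((IsCMField.complexConj F) • w).asIdeal : Ideal (𝓞 F)) = ⊤) ∧
    (∀ (σ₀ : AlgebraicClosure (w.adicCompletion F) →+* ℂ), σ₀.comp (algebraMap F (AlgebraicClosure (w.adicCompletion F))) = ι₁ →
      ∀ (τR : (F →+* AlgebraicClosure (w.adicCompletion F)) → (𝓞 F →+* ↥(closureValuationSubring (w.adicCompletion F)))),
        (∀ (τ : F →+* AlgebraicClosure (w.adicCompletion F)) (x : 𝓞 F),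
          ((τR τ x : ↥(closureValuationSubring (w.adicCompletion F))) : AlgebraicClosure (w.adicCompletion F)) = τ (x : F)) →
      ∀ (σ : Field.absoluteGaloisGroup (w.adicCompletion F)), IsAbsArithFrob σ → ∀ γ : Fi ≃ₐ[F] Fi,
        ((AlgEquiv.restrictScalars F (Field.absoluteGaloisGroup.toAlgEquiv (w.adicCompletion F) σ) :
            AlgebraicClosure (w.adicCompletion F) ≃ₐ[F] AlgebraicClosure (w.adicCompletion F)) :
            AlgebraicClosure (w.adicCompletion F) →ₐ[F] AlgebraicClosure (w.adicCompletion F)).comp e = e.comp (γ : Fi →ₐ[F] Fi) →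
        twistIdeal γ = ∏ τ ∈ Finset.univ.filter (fun τ : F →+* AlgebraicClosure (w.adicCompletion F) =>
            mOf ι₁ Φ (σ₀.comp τ) ≠ 0 ∧ RingHom.ker ((IsLocalRing.residue ↥(closureValuationSubring (w.adicCompletion F))).comp (τR τ)) ≠
              (((IsCMField.complexConj F) • w).asIdeal : Ideal (𝓞 F))),
          RingHom.ker ((IsLocalRing.residue ↥(closureValuationSubring (w.adicCompletion F))).comp (τR τ))) ∧
    ∀ γ : Fi ≃ₐ[F] Fi, IsSheetTwistOf ι₁ τE Φ hΦ N γ (twistIdeal γ) (twistNorm γ)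

/-- **SOCKET `stub_TWIST`** — the arithmetic organ (S6) ⊕ (S7); NOT proved here (organ hands by name: LA7-p02 (g3) (S6), LA6-p02 (g2) junction bookkeeping,
LA4-p04 (g2) (S7), LA4-p05 (g3) type-product rows). [cite: Shimura1998, §18.6 proof pp. 127–129] [cite: MilneCM2006, Ch. I §1 Prop. 1.26] -/
theorem stub_TWIST : OrganTWIST := by
  classical
  intro F _ _ _ _ ι₁ Fi _ _ _ _ τE hτE Φ hΦ N hN w hw pChar fDeg hp hpw hcard hNdvd had hun e
  -- (1) a complex embedding `σ₁ : F̄_w → ℂ` over `ι₁` (★ p849445) and the restriction family `τR₁` (★ `exists_restrict`)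
  obtain ⟨ρ₁, hρ₁⟩ := Literature.FieldTheory.AlgClosed.exists_ringEquiv_algebraicClosure_adicCompletion_complex_comp_eq F w ι₁
  set σ₁ : AlgebraicClosure (w.adicCompletion F) →+* ℂ := (ρ₁ : AlgebraicClosure (w.adicCompletion F) →+* ℂ) with hσ₁def
  have hσ₁ : σ₁.comp (algebraMap F (AlgebraicClosure (w.adicCompletion F))) = ι₁ := hρ₁
  have hσ₁' : σ₁.comp ((algebraMap (w.adicCompletion F) (AlgebraicClosure (w.adicCompletion F))).comp
      (algebraMap F (w.adicCompletion F))) = ι₁ := by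
    rw [← IsScalarTower.algebraMap_eq]; exact hσ₁
  obtain ⟨τR₁, hτR₁⟩ := Summit.HodgeConjecture.HodgeConjecture.Theorems.F0P6aKottwitzCountAtSplitPlace.exists_restrict (w := w)
  -- (2) the Kottwitz rows of `m₁ := mOf ι₁ Φ (σ₁ ∘ ·)` (as ★ `kottRows_explicit`: pair ⇐ `hΦ`, banal, unmixed ⇐ `hun`, count ⇐ `had`)
  have hpair : ∀ τ : F →+* AlgebraicClosure (w.adicCompletion F),
      mOf ι₁ Φ (σ₁.comp τ) + mOf ι₁ Φ (σ₁.comp (τ.comp ((IsCMField.complexConj F : F ≃ₐ[↥(maximalRealSubfield F)] F) : F →+* F))) = 2 :=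
    fun τ => F0P6aPELInputs.mOf_comp_add_mOf_comp_complexConj_eq_two ι₁ Φ hΦ w σ₁ τ
  have hbanal : ∀ τ : F →+* AlgebraicClosure (w.adicCompletion F),
      RingHom.ker ((IsLocalRing.residue ↥(closureValuationSubring (w.adicCompletion F))).comp (τR₁ τ)) ≠ (w.asIdeal : Ideal (𝓞 F)) →
      RingHom.ker ((IsLocalRing.residue ↥(closureValuationSubring (w.adicCompletion F))).comp (τR₁ τ)) ≠
        (((IsCMField.complexConj F) • w).asIdeal : Ideal (𝓞 F)) →
      mOf ι₁ Φ (σ₁.comp τ) = 0 ∨ mOf ι₁ Φ (σ₁.comp τ) = 2 :=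
    fun τ h₁ h₂ => F0P6aPELInputs.mOf_comp_eq_zero_or_two_of_ker_ne ι₁ Φ w τR₁ hτR₁ σ₁ hσ₁' τ h₁ h₂
  have hunmixed : ∀ τ τ' : F →+* AlgebraicClosure (w.adicCompletion F),
      RingHom.ker ((IsLocalRing.residue ↥(closureValuationSubring (w.adicCompletion F))).comp (τR₁ τ)) =
        RingHom.ker ((IsLocalRing.residue ↥(closureValuationSubring (w.adicCompletion F))).comp (τR₁ τ')) →
      RingHom.ker ((IsLocalRing.residue ↥(closureValuationSubring (w.adicCompletion F))).comp (τR₁ τ)) ≠ w.asIdeal →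
      RingHom.ker ((IsLocalRing.residue ↥(closureValuationSubring (w.adicCompletion F))).comp (τR₁ τ)) ≠
        ((IsCMField.complexConj F) • w).asIdeal →
      mOf ι₁ Φ (σ₁.comp τ) = mOf ι₁ Φ (σ₁.comp τ') :=
    fun τ τ' hker h₁ h₂ => F0P6aStubKOTT.mOf_comp_eq_of_unmixedAt ι₁ w Φ τR₁ hτR₁ σ₁ hσ₁' hun τ τ' hker h₁ h₂
  have hcount : ∑ τ ∈ (Finset.univ.filter fun τ : F →+* AlgebraicClosure (w.adicCompletion F) =>
      RingHom.ker ((IsLocalRing.residue ↥(closureValuationSubring (w.adicCompletion F))).comp (τR₁ τ)) =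
        (((IsCMField.complexConj F) • w).asIdeal : Ideal (𝓞 F))), mOf ι₁ Φ (σ₁.comp τ) = 1 := by
    -- THE COUNT (★ `kottRows_explicit`, token for token with `T.Φ ↦ Φ`, `T.hΦw ↦ had`)
    have hτwc : σ₁.comp (((algebraMap (w.adicCompletion F) (AlgebraicClosure (w.adicCompletion F))).comp
        (algebraMap F (w.adicCompletion F))).comp ((IsCMField.complexConj F : F ≃ₐ[↥(maximalRealSubfield F)] F) : F →+* F)) =
        ComplexEmbedding.conjugate ι₁ := by
      rw [← F0P6aStubKOTT.conjugate_comp_eq w σ₁, hσ₁']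
    have hinj : ∀ τ τ' : F →+* AlgebraicClosure (w.adicCompletion F), σ₁.comp τ = σ₁.comp τ' → τ = τ' :=
      fun τ τ' h => RingHom.ext fun x => σ₁.injective (RingHom.congr_fun h x)
    refine Summit.HodgeConjecture.HodgeConjecture.Theorems.F0P6aKottwitzCountAtSplitPlace.sum_filter_ker_residue_restrict_eq_one w τR₁ hτR₁ hw
      (Finset.univ.filter fun τ => σ₁.comp τ ∈ Φ) _ ?_ ?_ ?_
    · intro τ hτ hne
      exact Finset.mem_filter.mpr ⟨Finset.mem_univ _, had τR₁ hτR₁ σ₁ hσ₁' τ hτ hne⟩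
    · show mOf ι₁ Φ _ = 1
      rw [hτwc]
      simp only [mOf, or_true, if_true]
    · intro τ hτ hne hnec
      have h₁ : σ₁.comp τ ≠ ι₁ := fun h => hne (hinj _ _ (h.trans hσ₁'.symm))
      have h₂ : σ₁.comp τ ≠ ComplexEmbedding.conjugate ι₁ := fun h => hnec (hinj _ _ (h.trans hτwc.symm))
      show mOf ι₁ Φ _ = 0
      simp only [mOf, h₁, h₂, or_self, if_false, (Finset.mem_filter.mp hτ).2, if_true]
  -- (3) the rows (a)(b)(c) of the Shimura–Taniyama datum `𝔞_can(m₁, τR₁, w)` (★ p849355) and the (S7) pin `g_F(𝔭_w) = 𝔞_can` (LA4-p04 (g2) (S7-F))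
  obtain ⟨⟨h0a, h0b, h0c, -, -⟩, -⟩ :=
    Summit.HodgeConjecture.HodgeConjecture.Theorems.F0P6aCanonicalTwistIdealArithRows.canonicalTwistIdeal_eLetterRows_sigma w ι₁ (mOf ι₁ Φ) σ₁ hσ₁
      τR₁ hτR₁ hpair hcount hbanal hw hp hpw hcard hNdvd
  have hS7F : Literature.NumberTheory.ComplexMultiplication.idealReflexTypeNorm
      (Literature.NumberTheory.ComplexMultiplication.valuedIn ι₁ (twistType ι₁ Φ hΦ).1) (RingHom.id F) (RingHom.id F) w.asIdeal =
      ∏ τ ∈ Finset.univ.filter (fun τ : F →+* AlgebraicClosure (w.adicCompletion F) =>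
          mOf ι₁ Φ (σ₁.comp τ) ≠ 0 ∧ RingHom.ker ((IsLocalRing.residue ↥(closureValuationSubring (w.adicCompletion F))).comp (τR₁ τ)) ≠
            (((IsCMField.complexConj F) • w).asIdeal : Ideal (𝓞 F))),
        RingHom.ker ((IsLocalRing.residue ↥(closureValuationSubring (w.adicCompletion F))).comp (τR₁ τ)) :=
    s7F_pin ι₁ Φ hΦ w hw σ₁ hσ₁' τR₁ hτR₁ had
  -- (4) the zip at `Adm := IsSheetTwistOf`, the two junction legs by ★ p850275 (generic) and p850297 (Frobenius coset)
  have hN0 : N ≠ 0 := by omega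
  obtain ⟨tI, tN, ha, hb, hc, hFa, hFn, hπ, hcan, -, hadm⟩ :=
    Summit.HodgeConjecture.HodgeConjecture.Theorems.F0P6aTwistDataOfKottRows.exists_twistData_letterRows_of_kottRows w e ι₁ (mOf ι₁ Φ) σ₁ hσ₁
      τR₁ hτR₁ hpair hcount hbanal hunmixed hw hp hpw hcard hNdvd (fun γ 𝔞 n => IsSheetTwistOf ι₁ τE Φ hΦ N γ 𝔞 n)
      (fun σ hσ γ hσγ => by
        obtain ⟨γ', sE, hl, hf, hs, hz, hcg⟩ :=
          Summit.HodgeConjecture.HodgeConjecture.Theorems.F0P6aSheetTwistFrobenius.exists_sheetTwist_frobenius ι₁ (twistType ι₁ Φ hΦ) τE hτE N w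
            hp hpw hNdvd e hσ γ hσγ _ hS7F
        exact ⟨h0a, h0b, h0c, γ', sE, _, hl, hf, hs, rfl, hz, hcg⟩)
      (fun γ => by
        obtain ⟨𝔞, n, γ', sE, hl, hf, hs, hz, hcg, hga, hgb, hgc, hgd⟩ :=
          Summit.HodgeConjecture.HodgeConjecture.Theorems.F0P6aSheetTwistGeneric.exists_sheetTwist_generic ι₁ (twistType ι₁ Φ hΦ) τE hτE hN0 γ
        exact ⟨𝔞, n, ⟨hga, hgb, hgc, γ', sE, _, hl, hf, hs, rfl, hz, hcg⟩, hga, hgb, hgc, hgd⟩)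
  exact ⟨tI, tN, ha, hb, hc, hFa, hFn, hπ, hcan, hadm⟩

/-! ### §3 ORGAN «SHEET LAW» (geometric: (S1)–(S5)) -/

set_option maxHeartbeats 400000 in
/-- **`OrganSHEET`** — in the letter՚s chart context (record system `S`, small level `Kc`, slice field `Fᵢ`, frame `Φ`, chart `C` pinned on the frame `Fr`, slice
`ε` inducing `C.f`, `𝒪_F`-action `ρ` on the canonical pull-back `P := C.𝓜.univ ×_{𝓜.M} X` with its READING), at every place `w` with `c•w ≠ w`: for every
`γ ∈ Gal(Fᵢ∕F)` and every `(𝔞, n)` with `IsSheetTwistOf ι₁ τE Φ hΦ C.N γ 𝔞 n`, the SHEET LAW between the `e′`- and the `e′∘γ`-sheets — (K-law)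
`CoverKerE S Kc w e′ P.A ρ P.D P.pol P.level (e′ ∘ γ) 𝔞 n y` and (cover) `CoverE …` at every `F̄_w`-sheet `e′` and point `y` (letter rows TOKEN FOR TOKEN with
`twistIdeal γ ↦ 𝔞`, `twistNorm γ ↦ n`).  ROAD (organ hands): (S1) the Serre-tensored tuple `P_𝔞 ∈ 𝓜_{g,δ,N}(X)` with its cover (★ p849895 `SerreTwistModuliTuple`);
(S2b) its marked fibres are the `ũ_V(1,z)`-translates (★ p849685∕p849931); (S2a)+(S3♯) at the special point of `w` the `γ̃`-conjugate slice and `ψ_𝔞` agree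
(★ p849972∕p849999 forward law at `σL := γ̃`, `uE := sE`, central factor `t = z = t(sE)`; LA4-p03 (g2) chart zip `gal_conj_slice_eq_sliceTwo_of_chartOfFrame` v2 6e4a4155); (S3) `T′ = ψ_𝔞` by density + separatedness (★ p849897∕p849947); (S4) fine
moduli ⇒ `P_{τE∘γ} ≅ P_𝔞` ⇒ the rows at every point (★ `SerreCoverTransportAlongIso`); (S5) `F̄_w ↔ ℂ` (★ p849445∕p849519).  NOT asserted here (socket `stub_SHEET`).
Why it might fail: the lift-independence — two lifts `γ̃, γ̃′` of `γ` differ by `Aut(ℂ∕τE Fᵢ)` whose torus coordinate is absorbed by the chart՚s `f_recip` over the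
slice field (E3R) — is used INSIDE (S3); the junction՚s `∃ γ̃` is therefore the right quantifier only because `C` is a chart over `Fᵢ`.
(print: Shimura1998, §13.1 Thm. 1 pp. 97–99; §18.6 Thm. 18.6 pp. 124–125) (print: RapoportSmithlingZhang2020Diagonal, §3.2 p. 11, §4.3 p. 20) (print: Conrad2004GrossZagier, §7, Thm. 7.6) -/
def OrganSHEET : Prop :=
  ∀ (F : Type) [Field F] [NumberField F] [IsCMField F] [IsGalois ℚ F] (ι₁ : F →+* ℂ)
    (Jstar : Matrix (Fin 2) (Fin 2) F) (hJ : (Jstar.map (IsCMField.complexConj F))ᵀ = Jstar) (hJu : IsUnit Jstar)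
    (K₀ : C5.OpenCompactSubgroup (GSAdele F Jstar)) (S : RecordSystemGS F Jstar ι₁ K₀) (_hU7ₛ : S.HeckeTranslateDefinedOver) (Kc : C5.SmallLevel K₀)
    (Fi : Type) [Field Fi] [NumberField Fi] [Algebra F Fi] [IsGalois F Fi] (τE : Fi →+* ℂ) (_hτE : τE.comp (algebraMap F Fi) = ι₁)
    (Φ : Set (F →+* ℂ)) (hΦ : IsCMTypeThrough ι₁ Φ) (C : AuxChartGS F ι₁ Jstar K₀ S Kc Fi τE Φ)
    (ξ : F) (k : ℕ) (Fr : SymplecticFrameV F (RingHom.id F) Jstar ((k : ℚ) • ξ) C.g C.δ) (_hpin : IsChartOfFrame hΦ C ξ k Fr)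
    (ε : (Literature.AlgebraicGeometry.Motives.baseChange F Fi).obj (S.M.obj Kc) ⟶
        (Literature.AlgebraicGeometry.Motives.baseChange ℚ Fi).obj C.𝓜.M)
    (_hε : letI : Algebra Fi ℂ := τE.toAlgebra
      ∀ (P : ComplexPoints ((Literature.AlgebraicGeometry.Motives.baseChange F Fi).obj (S.M.obj Kc)))
        (Pflat : letI : Algebra F ℂ := ι₁.toAlgebra; ComplexPoints (S.M.obj Kc)),
        Pflat.left = P.left ≫ pullback.fst (S.M.obj Kc).hom (bcSpec F Fi) →
        (AlgPoints.map ε P).left ≫ pullback.fst C.𝓜.M.hom (bcSpec ℚ Fi) =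
          (letI : Algebra F ℂ := ι₁.toAlgebra; (C.f (S.pts Kc Pflat)).left))
    (ρ : AbelianSchemeOver.RingAction (𝓞 F) (C.𝓜.univ.baseChange (ε.left ≫ pullback.fst C.𝓜.M.hom (bcSpec ℚ Fi))).A),
    RingActionReading C ε ρ →
    ∀ (w : HeightOneSpectrum (𝓞 F)) (_hw : (IsCMField.complexConj F) • w ≠ w)
      (γ : Fi ≃ₐ[F] Fi) (𝔞 : Ideal (𝓞 F)) (n : ℕ), IsSheetTwistOf ι₁ τE Φ hΦ C.N γ 𝔞 n →
        letI P := C.𝓜.univ.baseChange (ε.left ≫ pullback.fst C.𝓜.M.hom (bcSpec ℚ Fi))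
  (∀ (e' : Fi →ₐ[F] AlgebraicClosure (w.adicCompletion F))
      (y : AlgPoints (S.M.obj Kc) (AlgebraicClosure (w.adicCompletion F))),
      CoverKerE S Kc w e' P.A ρ P.D P.pol P.level (e'.comp (γ : Fi →ₐ[F] Fi)) 𝔞 n y) ∧
    ∀ (e' : Fi →ₐ[F] AlgebraicClosure (w.adicCompletion F))
      (y : AlgPoints (S.M.obj Kc) (AlgebraicClosure (w.adicCompletion F))),
      CoverE S Kc w e' P.A ρ P.D P.pol P.level (e'.comp (γ : Fi →ₐ[F] Fi)) 𝔞 n y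

/-! ### §3b LEG-E (LA7-p01 (g3), #29 lead hand, ROAD B′∕(β)) — `OrganSHEET` FROM THE COMPLEX ROWS ON THE CHART SHEET `τE` ALONE

The `F̄_w`-side of `OrganSHEET` is discharged here: by (S5) (`coverKerE_of_complex_sheet`, `σ : F̄_w ≃ₐ[F] ℂ` RELATIVE to the sheet `e′`, ★ p850285) both rows at
EVERY `F̄_w`-sheet `e′` and point `y` follow from the kernel-clause body `coverKerBody ℂ …` at the complex points `(ℓ_{τE} z, ℓ_{τE∘γ} z)` of the ONE chart sheet
`τE`; the cover row is the kernel row minus (t1′) (`coverE_of_coverKerE`).  What remains is the purely complex-analytic organ `OrganSHEETComplex` (socket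
`hole_SHEET_complex`): per complex point `z`, B′ = DEAL #32 marked Serre tensor of the fibre (LA4-p03) + #33 `hr` (LA4-p05) + #34 ADM ⇒ ISO (A-p14) + #35 `f₂`
continuous (LA4-p01) + (β1) density (LA4-p03) + LEG-C point law at CM points (★ p849999∕(S3♯)). -/

/-- The chart sheet `τE` as an `F`-algebra hom `Fᵢ →ₐ[F] ℂ` (`ℂ` an `F`-algebra through `ι₁`; `τE ∘ (F → Fᵢ) = ι₁`). -/
def sheetAlgHom {F : Type} [Field F] (ι₁ : F →+* ℂ) {Fi : Type} [Field Fi] [Algebra F Fi] (τE : Fi →+* ℂ)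
    (hτE : τE.comp (algebraMap F Fi) = ι₁) : letI : Algebra F ℂ := ι₁.toAlgebra; Fi →ₐ[F] ℂ :=
  letI : Algebra F ℂ := ι₁.toAlgebra
  { τE with commutes' := fun r => RingHom.congr_fun hτE r }

/-- `sheetAlgHom ι₁ τE hτE` is `τE` on elements. -/
@[simp] theorem sheetAlgHom_apply {F : Type} [Field F] (ι₁ : F →+* ℂ) {Fi : Type} [Field Fi] [Algebra F Fi] (τE : Fi →+* ℂ)
    (hτE : τE.comp (algebraMap F Fi) = ι₁) (x : Fi) :
    (letI : Algebra F ℂ := ι₁.toAlgebra; sheetAlgHom ι₁ τE hτE x) = τE x := rfl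

set_option maxHeartbeats 400000 in
open scoped MonObj Obj in
/-- **LEG-E GLUE: THE KERNEL-CLAUSE BODY FROM ROWS INTO A TWISTED OBJECT `B` PLUS AN ISOMORPHISM `B ≅ P_{ℓ′}`** (★ body currency, any point field `Ω`).
If `c₀ : P_ℓ → B` carries the rows (t1)(t1′)(t2)(t3)(t4)(t5) relative to `(actB, DB, polB, sB)` (DEAL #32՚s marked Serre tensor of the fibre) and
`e : B ≅ P_{ℓ′}` is a homomorphism matching action, polarisation and level points (DEAL #34 ADM ⇒ ISO: `hact`, `hlam`, `hpt`), then `c := c₀ ≫ e` witnesses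
`coverKerBody Ω P.A ρ P.D P.pol P.level 𝔞 n ℓ ℓ′` ((t3) by ★ `dualIsogenyOver_comp`, (t1′) by ★ `comp_eq_one_iff_of_iso_comp_eq`).
[cite: Shimura1998, §13.1 Thm. 1 pp. 97–99; §18.6] [cite: MumfordAV1970, §7 Thm. 4 (p. 72); §15 Thm. 1 (p. 143)] -/
theorem coverKerBody_of_rows_comp_iso {F : Type} [Field F] [NumberField F] [IsCMField F] {Y : Scheme.{0}} {Ω : Type} [Field Ω]
    {univ : AbelianSchemeOver Y} (act : AbelianSchemeOver.RingAction (𝓞 F) univ) (dual : univ.DualPair) (pol : univ.Polarization dual)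
    {g N : ℕ} (lvl : univ.LevelStructure g N) (𝔞 : Ideal (𝓞 F)) (n : ℕ) (ℓ ℓ' : Spec (.of Ω) ⟶ Y)
    {B : AbelianSchemeOver (Spec (.of Ω))} (actB : AbelianSchemeOver.RingAction (𝓞 F) B) (DB : B.DualPair) (polB : B.Polarization DB)
    (sB : (Fin g ⊕ Fin g → ZMod N) → AlgPoints B.X Ω)
    (c₀ : (univ.baseChange ℓ).X ⟶ B.X) [IsMonHom c₀]
    (t1 : ∀ a ∈ 𝔞, ∃ d : B.X ⟶ (univ.baseChange ℓ).X,
      c₀ ≫ d = AbelianSchemeOver.baseChangeHom (act.i a) ℓ ∧ d ≫ c₀ = actB.i a)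
    (t1' : ∀ ⦃T : SchemeOver Ω⦄ (t : T ⟶ (univ.baseChange ℓ).X),
      t ≫ c₀ = 1 ↔ ∀ a ∈ 𝔞, t ≫ AbelianSchemeOver.baseChangeHom (act.i a) ℓ = 1)
    (t2 : ∀ b ∈ (IsCMField.complexConj F) • 𝔞, ∃ f : (univ.baseChange ℓ).X ⟶ B.X, c₀ ≫ actB.i b = f ≫ actB.i (n : 𝓞 F))
    (t3 : c₀ ≫ polB.lam ≫ AbelianSchemeOver.DualPair.dualIsogenyOver c₀ (dual.baseChange ℓ) DB =
      (pol.baseChange ℓ).lam ≫ (dual.baseChange ℓ).hat.mulN n)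
    (t4 : ∀ a : 𝓞 F, AbelianSchemeOver.baseChangeHom (act.i a) ℓ ≫ c₀ = c₀ ≫ actB.i a)
    (t5 : ∀ a : Fin g ⊕ Fin g → ZMod N, (AlgPoints.map c₀ (univ.restrictPt ℓ (lvl.section_ a)) : AlgPoints B.X Ω) = sB a)
    (e : B.X ≅ (univ.baseChange ℓ').X) [IsMonHom e.hom]
    (hact : ∀ a : 𝓞 F, actB.i a ≫ e.hom = e.hom ≫ AbelianSchemeOver.baseChangeHom (act.i a) ℓ')
    (hlam : e.hom ≫ (pol.baseChange ℓ').lam ≫ AbelianSchemeOver.DualPair.dualIsogenyOver e.hom DB (dual.baseChange ℓ') = polB.lam)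
    (hpt : ∀ a : Fin g ⊕ Fin g → ZMod N,
      (AlgPoints.map e.hom (sB a) : (univ.baseChange ℓ').toAffine.toAbelianVariety.Points Ω) = univ.restrictPt ℓ' (lvl.section_ a)) :
    F0P6aCoverEOfComplex.coverKerBody Ω univ act dual pol lvl 𝔞 n ℓ ℓ' := by
  refine ⟨c₀ ≫ e.hom, inferInstance, fun a ha => ?_, fun T t => ?_, fun b hb => ?_, ?_, fun a => ?_, fun a => ?_⟩
  · obtain ⟨d, hcd, hdc⟩ := t1 a ha
    refine ⟨e.inv ≫ d, by rw [Category.assoc, e.hom_inv_id_assoc, hcd], ?_⟩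
    rw [Category.assoc, ← Category.assoc d, hdc, hact, e.inv_hom_id_assoc]
  · rw [← t1' t]
    exact (AbelianSchemeOver.comp_eq_one_iff_of_iso_comp_eq (univ.baseChange ℓ) c₀ (c₀ ≫ e.hom) e rfl t).symm
  · obtain ⟨f, hf⟩ := t2 b hb
    refine ⟨f ≫ e.hom, ?_⟩
    rw [Category.assoc, ← hact, ← Category.assoc, hf, Category.assoc, hact, Category.assoc]
  · rw [AbelianSchemeOver.DualPair.dualIsogenyOver_comp c₀ e.hom (dual.baseChange ℓ) DB (dual.baseChange ℓ')]
    have hlam' : e.hom ≫ (pol.baseChange ℓ').lam ≫ AbelianSchemeOver.DualPair.dualIsogenyOver e.hom DB (dual.baseChange ℓ') ≫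
        AbelianSchemeOver.DualPair.dualIsogenyOver c₀ (dual.baseChange ℓ) DB =
        polB.lam ≫ AbelianSchemeOver.DualPair.dualIsogenyOver c₀ (dual.baseChange ℓ) DB := by
      rw [← hlam]; simp only [Category.assoc]
    simp only [Category.assoc]
    rw [hlam']
    exact t3
  · rw [← Category.assoc, t4 a, Category.assoc, hact a, Category.assoc]
  · exact (AlgPoints.map_comp_apply c₀ e.hom _).trans ((congrArg (AlgPoints.map e.hom) (t5 a)).trans (hpt a))

end Summit.HodgeConjecture.HodgeConjecture.Cruxes.HLiu418.F0P6aStubESHEET
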